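import Literature.AnabelianGeometry.SemiGraphs.PSCSeparatingCoveringsThreeChainUnmarkedMidVertices
import Literature.AnabelianGeometry.SemiGraphs.PSCSeparatingCoveringsThreeChainUnmarkedMidEdges
import Literature.AnabelianGeometry.SemiGraphs.PSCUnrVerticialSeparatingCoveringsThreeChainOfNe
import Literature.AnabelianGeometry.SemiGraphs.PSCSeparatingCoveringsThreeChainAll
import HarnessLib

/-!
# [CombGC] Prop. 1.2 IN FULL and the separating coverings (rows F-2828, F-2829, F-2830, F-0438, F-0459) at THREE-COMPONENT CHAINS with an UNMARKED MIDDLE component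

Mochizuki, *A combinatorial version of the Grothendieck conjecture*, Tohoku Math. J. **59** (2007)
[CombGC], Proposition 1.2 (i)(ii) p. 8 and its PROOF p. 9 [cite: MochizukiCombGC2007, Prop 1.2 pp.8-9]: the
separating-coverings step typed LEVEL-WISE as `PSCDatum.SeparatingCoverings` / `SeparatingCoveringsHolds Ω`
(abc-iut-w4-d081, row P12-L01; abc-iut FACT-LIST rows F-2829 / F-2830), its `Π^unr` conjunct (F-2828) and the
printed statements `OpenInterDeterminesComponentHolds Ω` (F-0459), `CommensurableTerminalityHolds Ω` (F-0438) —
schemata whose universal closures are refuted as typed; the instance forms at genuine carriers are the content.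

PROOF-ONLY file (abc-iut-f-166 gen 6, row «UNMARKED-MIDDLE-CHAIN», file 3 = capstone; 0 definitions).  CAPSTONE at
abc-iut-f-164's three-component chain shape with the MIDDLE component UNMARKED (`s₁ = s₂`, `1 ≤ s₁ < r`,
`1 ≤ g₀ < g₁ < g`).

* `unrVerticialSeparatingCoverings_of_threeChain_unmarkedMid` — **F-2828** there, from gen 6's factorisation
  `unrVerticialSeparatingCoverings_of_threeChain_of_ne`; `ν_A ≠ ν_B` by the continuous extension of the Heisenberg
  handle-cusp quotient at the MIDDLE handle `g₀` with the `C₁` cusp `c_0` (`ε_A ↦ 1`, `η ↦ Z ≠ 1`);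
* `separatingCoverings_of_threeChain_unmarkedMid` — **F-2829**, all three conjuncts;
* `prop12_of_threeChain_unmarkedMid` — all five typed clauses of Prop. 1.2 (i)(ii) there;
* `exists_threeChainUnmarkedMidOrigin_prop12_holds_all` — **F-2830 ∧ F-0438 ∧ F-0459 at the INHABITED origin of
  ALL such chains**, inhabited by the chain `Γ_{3,3}` of genera `(1,1,1)` with two marked points on `C₀`, none on
  `C_mid`, one on `C₁` (abc-iut-f-164's `exists_threeChainDatum`).

Instance forms at data of the shape of genuine stable curves: consistency evidence for the typed schemata,
not the printed theorem for all pointed stable curves.  Nothing here takes a side on [IUTchIII] Cor. 3.12.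
-/



noncomputable section

namespace Literature.AnabelianGeometry.SemiGraphs

namespace PSCDatum

open scoped Pointwise
open Literature.AnabelianGeometry.Anabelioids (IsSigmaInteger)
open Literature.GroupTheory.CombinatorialGroupTheory
open Literature.GroupTheory.CombinatorialGroupTheory.PuncturedSurfaceGroup (cuspInertia)
open SemiGraphOfAnabelioids (IsProSigmaCompletion)

section Datum

variable {P : Type} [Group P] [TopologicalSpace P] [IsTopologicalGroup P]
variable [CompactSpace P] [TotallyDisconnectedSpace P] {Sigma : Set ℕ} {g r : ℕ}

/-- **Row P12-L01-U / F-2828 (`V' := V`) at EVERY three-component chain datum whose middle component is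
unmarked** (`s₁ = s₂`, `1 ≤ s₁ < r`, `1 ≤ g₀ < g₁ < g`): gen 6's `unrVerticialSeparatingCoverings_of_threeChain_of_ne`,
the two nodes being distinct because the continuous extension of the Heisenberg handle-cusp quotient
`(a_{g₀}, b_{g₀}, c_0) ↦ (X, Y, Z⁻¹)` mod `ℓ ∈ Σ` kills `cl ι⟨ε_A⟩` (`ε_A ↦ 1`) but maps `ι(η) ↦ Z ≠ 1`.
[cite: MochizukiCombGC2007, Prop 1.2 proof p.9] -/
theorem unrVerticialSeparatingCoverings_of_threeChain_unmarkedMid (hne : Sigma.Nonempty)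
    (hprime : ∀ p ∈ Sigma, p.Prime) (ι : PuncturedSurfaceGroup g r →* P)
    (hι : IsProSigmaCompletion Sigma ι) (G : PSCDatum P) {g₀ g₁ s₁ s₂ : ℕ} (hg : g₀ < g₁) (hg₁ : g₁ < g)
    (hs₁ : 1 ≤ s₁) (hs₁r : s₁ < r) (hs₂ : s₂ = s₁) (e : G.graph.C ≃ Fin r)
    (hC : ∀ c', G.cuspGp c' = ((cuspInertia (g := g) (e c')).map ι).topologicalClosure)
    (v₀ vm v₁ : G.graph.V) (hV : ∀ w, w = v₀ ∨ w = vm ∨ w = v₁) (εA η : PuncturedSurfaceGroup g r)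
    (hεA : εA = ((List.finRange r).map fun j : Fin r =>
          if s₂ ≤ (j : ℕ) then PuncturedSurfaceGroup.c (g := g) j else 1).prod *
        ((List.finRange g).map fun i : Fin g => if (i : ℕ) < g₀ then
          PuncturedSurfaceGroup.a (r := r) i * PuncturedSurfaceGroup.b i *
            (PuncturedSurfaceGroup.a i)⁻¹ * (PuncturedSurfaceGroup.b i)⁻¹ else 1).prod)
    (hη : η = ((List.finRange r).map fun j : Fin r =>
          if s₁ ≤ (j : ℕ) then PuncturedSurfaceGroup.c (g := g) j else 1).prod *
        ((List.finRange g).map fun i : Fin g => if (i : ℕ) < g₁ then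
          PuncturedSurfaceGroup.a (r := r) i * PuncturedSurfaceGroup.b i *
            (PuncturedSurfaceGroup.a i)⁻¹ * (PuncturedSurfaceGroup.b i)⁻¹ else 1).prod)
    (hV₀ : G.vertGp v₀ = ((Subgroup.closure {x : PuncturedSurfaceGroup g r |
        (∃ i : Fin g, (i : ℕ) < g₀ ∧ (x = PuncturedSurfaceGroup.a i ∨ x = PuncturedSurfaceGroup.b i)) ∨
        ∃ j : Fin r, s₂ ≤ (j : ℕ) ∧ x = PuncturedSurfaceGroup.c j}).map ι).topologicalClosure)
    (hVm : G.vertGp vm = ((Subgroup.closure {x : PuncturedSurfaceGroup g r |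
        (∃ i : Fin g, (g₀ ≤ (i : ℕ) ∧ (i : ℕ) < g₁) ∧
          (x = PuncturedSurfaceGroup.a i ∨ x = PuncturedSurfaceGroup.b i)) ∨
        (∃ j : Fin r, (s₁ ≤ (j : ℕ) ∧ (j : ℕ) < s₂) ∧ x = PuncturedSurfaceGroup.c j) ∨
        x = εA ∨ x = η}).map ι).topologicalClosure)
    (hV₁ : G.vertGp v₁ = ((Subgroup.closure {x : PuncturedSurfaceGroup g r |
        (∃ i : Fin g, g₁ ≤ (i : ℕ) ∧ (x = PuncturedSurfaceGroup.a i ∨ x = PuncturedSurfaceGroup.b i)) ∨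
        (∃ j : Fin r, (j : ℕ) < s₁ ∧ x = PuncturedSurfaceGroup.c j) ∨ x = η}).map ι).topologicalClosure)
    (nA nB : G.graph.N) (hN : ∀ n, n = nA ∨ n = nB)
    (hEA : G.nodeGp nA = ((Subgroup.zpowers εA).map ι).topologicalClosure)
    (hEB : G.nodeGp nB = ((Subgroup.zpowers η).map ι).topologicalClosure)
    (hgen₀ : G.genus v₀ = g₀) (hgenm : G.genus vm = g₁ - g₀) (hgen₁ : G.genus v₁ = g - g₁) :
    G.UnrVerticialSeparatingCoverings := by
  classical
  refine G.unrVerticialSeparatingCoverings_of_threeChain_of_ne hne hprime ι hι hg.le hg₁.le e hC v₀ vm v₁ hV εA η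
    hεA hη hV₀ hVm hV₁ nA nB hN hEA hEB ?_ hgen₀ hgenm hgen₁
  subst s₂
  obtain ⟨ℓ, hℓS⟩ := hne
  have hℓ : ℓ.Prime := hprime ℓ hℓS
  obtain ⟨φH, X, Y, Z, hXYZ, -, hZpow, hcard⟩ := Heisenberg.exists_heisenbergTriple_central ℓ
  haveI : Finite (Multiplicative (ZMod ℓ × ZMod ℓ) ⋊[φH] Multiplicative (ZMod ℓ)) :=
    Nat.finite_of_card_ne_zero (by rw [hcard]; exact pow_ne_zero _ hℓ.ne_zero)
  have hZ1 : Z ≠ 1 := fun h => hℓ.one_lt.ne' (Nat.dvd_one.mp ((hZpow 1).mp (by rw [pow_one, h])))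
  -- the Heisenberg quotient at the MIDDLE handle `g₀` with the `C₁` cusp `c_0`: `ε_A ↦ 1`, `η ↦ Z`
  obtain ⟨ψ, ha', hb', hc', hab, hcj⟩ := PuncturedSurfaceGroup.exists_hom_handle_cusp (g := g) (r := r)
    ⟨g₀, by omega⟩ ⟨0, by omega⟩ X Y Z⁻¹ (by rw [hXYZ, mul_inv_cancel])
  have hψA : ψ εA = 1 := by
    rw [hεA, PuncturedSurfaceGroup.hom_handle_cusp_nodeLoop ψ ha' hb' hc' hab hcj g₀ s₁,
      if_neg (show ¬ s₁ ≤ ((⟨0, _⟩ : Fin r) : ℕ) by simp only; omega),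
      if_neg (show ¬ ((⟨g₀, _⟩ : Fin g) : ℕ) < g₀ from lt_irrefl _), one_mul]
  have hψη : ψ η = Z := by
    rw [hη, PuncturedSurfaceGroup.hom_handle_cusp_nodeLoop ψ ha' hb' hc' hab hcj g₁ s₁,
      if_neg (show ¬ s₁ ≤ ((⟨0, _⟩ : Fin r) : ℕ) by simp only; omega),
      if_pos (show ((⟨g₀, _⟩ : Fin g) : ℕ) < g₁ by simp only; omega), one_mul, hXYZ]
  intro hABeq
  -- the continuous extension of `ψ` kills `cl ι⟨ε_A⟩ = Π_{nA} = Π_{nB} ∋ ι η`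
  letI : TopologicalSpace (Multiplicative (ZMod ℓ × ZMod ℓ) ⋊[φH] Multiplicative (ZMod ℓ)) := ⊥
  haveI : DiscreteTopology (Multiplicative (ZMod ℓ × ZMod ℓ) ⋊[φH] Multiplicative (ZMod ℓ)) := ⟨rfl⟩
  have hQ : IsSigmaInteger Sigma (Nat.card (Multiplicative (ZMod ℓ × ZMod ℓ) ⋊[φH] Multiplicative (ZMod ℓ))) := by
    rw [hcard]
    exact Literature.AnabelianGeometry.SemiGraphs.isSigmaInteger_prime_pow hℓ hℓS _
  obtain ⟨F, hFc, hF⟩ := SemiGraphOfAnabelioids.IsProSigmaCompletion.exists_continuous_extend_top hι hQ ψ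
  have hkerc : IsClosed ((F.ker : Subgroup P) : Set P) := by
    have hker : ((F.ker : Subgroup P) : Set P) = F ⁻¹' {1} := by
      ext x
      simp only [SetLike.mem_coe, MonoidHom.mem_ker, Set.mem_preimage, Set.mem_singleton_iff]
    rw [hker]
    exact (isClosed_discrete _).preimage hFc
  have hle : ((Subgroup.zpowers εA).map ι).topologicalClosure ≤ F.ker := by
    refine Subgroup.topologicalClosure_minimal _ ?_ hkerc
    rintro _ ⟨x, hx, rfl⟩
    obtain ⟨k, rfl⟩ := Subgroup.mem_zpowers_iff.mp hx
    rw [MonoidHom.mem_ker, hF, map_zpow, hψA, one_zpow]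
  have hmem : ι η ∈ ((Subgroup.zpowers εA).map ι).topologicalClosure := by
    rw [← hEA, hABeq, hEB]
    exact Subgroup.le_topologicalClosure _ (Subgroup.mem_map_of_mem ι (Subgroup.mem_zpowers η))
  have := hle hmem
  rw [MonoidHom.mem_ker, hF, hψη] at this
  exact hZ1 this

/-- **Row F-2829 `SeparatingCoverings` — all three conjuncts — at EVERY three-component chain datum whose middle
component is unmarked** (`s₁ = s₂`, `1 ≤ s₁ < r`, `1 ≤ g₀ < g₁ < g`, genera pinned).
[cite: MochizukiCombGC2007, Prop 1.2 proof p.9] -/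
theorem separatingCoverings_of_threeChain_unmarkedMid (hne : Sigma.Nonempty)
    (hprime : ∀ p ∈ Sigma, p.Prime) (ι : PuncturedSurfaceGroup g r →* P)
    (hι : IsProSigmaCompletion Sigma ι) (G : PSCDatum P) {g₀ g₁ s₁ s₂ : ℕ} (hg₀ : 1 ≤ g₀) (hg : g₀ < g₁)
    (hg₁ : g₁ < g) (hs₁ : 1 ≤ s₁) (hs₁r : s₁ < r) (hs₂ : s₂ = s₁) (e : G.graph.C ≃ Fin r)
    (hC : ∀ c', G.cuspGp c' = ((cuspInertia (g := g) (e c')).map ι).topologicalClosure)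
    (v₀ vm v₁ : G.graph.V) (hV : ∀ w, w = v₀ ∨ w = vm ∨ w = v₁) (εA η : PuncturedSurfaceGroup g r)
    (hεA : εA = ((List.finRange r).map fun j : Fin r =>
          if s₂ ≤ (j : ℕ) then PuncturedSurfaceGroup.c (g := g) j else 1).prod *
        ((List.finRange g).map fun i : Fin g => if (i : ℕ) < g₀ then
          PuncturedSurfaceGroup.a (r := r) i * PuncturedSurfaceGroup.b i *
            (PuncturedSurfaceGroup.a i)⁻¹ * (PuncturedSurfaceGroup.b i)⁻¹ else 1).prod)
    (hη : η = ((List.finRange r).map fun j : Fin r =>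
          if s₁ ≤ (j : ℕ) then PuncturedSurfaceGroup.c (g := g) j else 1).prod *
        ((List.finRange g).map fun i : Fin g => if (i : ℕ) < g₁ then
          PuncturedSurfaceGroup.a (r := r) i * PuncturedSurfaceGroup.b i *
            (PuncturedSurfaceGroup.a i)⁻¹ * (PuncturedSurfaceGroup.b i)⁻¹ else 1).prod)
    (hV₀ : G.vertGp v₀ = ((Subgroup.closure {x : PuncturedSurfaceGroup g r |
        (∃ i : Fin g, (i : ℕ) < g₀ ∧ (x = PuncturedSurfaceGroup.a i ∨ x = PuncturedSurfaceGroup.b i)) ∨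
        ∃ j : Fin r, s₂ ≤ (j : ℕ) ∧ x = PuncturedSurfaceGroup.c j}).map ι).topologicalClosure)
    (hVm : G.vertGp vm = ((Subgroup.closure {x : PuncturedSurfaceGroup g r |
        (∃ i : Fin g, (g₀ ≤ (i : ℕ) ∧ (i : ℕ) < g₁) ∧
          (x = PuncturedSurfaceGroup.a i ∨ x = PuncturedSurfaceGroup.b i)) ∨
        (∃ j : Fin r, (s₁ ≤ (j : ℕ) ∧ (j : ℕ) < s₂) ∧ x = PuncturedSurfaceGroup.c j) ∨
        x = εA ∨ x = η}).map ι).topologicalClosure)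
    (hV₁ : G.vertGp v₁ = ((Subgroup.closure {x : PuncturedSurfaceGroup g r |
        (∃ i : Fin g, g₁ ≤ (i : ℕ) ∧ (x = PuncturedSurfaceGroup.a i ∨ x = PuncturedSurfaceGroup.b i)) ∨
        (∃ j : Fin r, (j : ℕ) < s₁ ∧ x = PuncturedSurfaceGroup.c j) ∨ x = η}).map ι).topologicalClosure)
    (nA nB : G.graph.N) (hN : ∀ n, n = nA ∨ n = nB)
    (hEA : G.nodeGp nA = ((Subgroup.zpowers εA).map ι).topologicalClosure)
    (hEB : G.nodeGp nB = ((Subgroup.zpowers η).map ι).topologicalClosure)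
    (hgen₀ : G.genus v₀ = g₀) (hgenm : G.genus vm = g₁ - g₀) (hgen₁ : G.genus v₁ = g - g₁) :
    G.SeparatingCoverings :=
  ⟨G.verticialSeparatingCoverings_of_threeChain_unmarkedMid hne hprime ι hι hg₀ hg hg₁ hs₁ hs₁r hs₂ v₀ vm v₁ hV
      εA η hεA hη hV₀ hVm hV₁,
    G.edgeLikeSeparatingCoverings_of_threeChain_unmarkedMid hne hprime ι hι hg₀ hg hg₁ hs₁ hs₁r hs₂ e hC εA η hεA
      hη nA nB hN hEA hEB,
    G.unrVerticialSeparatingCoverings_of_threeChain_unmarkedMid hne hprime ι hι hg hg₁ hs₁ hs₁r hs₂ e hC v₀ vm v₁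
      hV εA η hεA hη hV₀ hVm hV₁ nA nB hN hEA hEB hgen₀ hgenm hgen₁⟩

/-- **[CombGC] Prop. 1.2 (i) and (ii) IN FULL at EVERY three-component chain datum whose middle component is
unmarked** (abc-iut-w5-d183's `prop12_of_separating` applied to F-2829 above).
[cite: MochizukiCombGC2007, Prop 1.2 pp.8-9] -/
theorem prop12_of_threeChain_unmarkedMid (hne : Sigma.Nonempty)
    (hprime : ∀ p ∈ Sigma, p.Prime) (ι : PuncturedSurfaceGroup g r →* P)
    (hι : IsProSigmaCompletion Sigma ι) (G : PSCDatum P) {g₀ g₁ s₁ s₂ : ℕ} (hg₀ : 1 ≤ g₀) (hg : g₀ < g₁)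
    (hg₁ : g₁ < g) (hs₁ : 1 ≤ s₁) (hs₁r : s₁ < r) (hs₂ : s₂ = s₁) (e : G.graph.C ≃ Fin r)
    (hC : ∀ c', G.cuspGp c' = ((cuspInertia (g := g) (e c')).map ι).topologicalClosure)
    (v₀ vm v₁ : G.graph.V) (hV : ∀ w, w = v₀ ∨ w = vm ∨ w = v₁) (εA η : PuncturedSurfaceGroup g r)
    (hεA : εA = ((List.finRange r).map fun j : Fin r =>
          if s₂ ≤ (j : ℕ) then PuncturedSurfaceGroup.c (g := g) j else 1).prod *
        ((List.finRange g).map fun i : Fin g => if (i : ℕ) < g₀ then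
          PuncturedSurfaceGroup.a (r := r) i * PuncturedSurfaceGroup.b i *
            (PuncturedSurfaceGroup.a i)⁻¹ * (PuncturedSurfaceGroup.b i)⁻¹ else 1).prod)
    (hη : η = ((List.finRange r).map fun j : Fin r =>
          if s₁ ≤ (j : ℕ) then PuncturedSurfaceGroup.c (g := g) j else 1).prod *
        ((List.finRange g).map fun i : Fin g => if (i : ℕ) < g₁ then
          PuncturedSurfaceGroup.a (r := r) i * PuncturedSurfaceGroup.b i *
            (PuncturedSurfaceGroup.a i)⁻¹ * (PuncturedSurfaceGroup.b i)⁻¹ else 1).prod)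
    (hV₀ : G.vertGp v₀ = ((Subgroup.closure {x : PuncturedSurfaceGroup g r |
        (∃ i : Fin g, (i : ℕ) < g₀ ∧ (x = PuncturedSurfaceGroup.a i ∨ x = PuncturedSurfaceGroup.b i)) ∨
        ∃ j : Fin r, s₂ ≤ (j : ℕ) ∧ x = PuncturedSurfaceGroup.c j}).map ι).topologicalClosure)
    (hVm : G.vertGp vm = ((Subgroup.closure {x : PuncturedSurfaceGroup g r |
        (∃ i : Fin g, (g₀ ≤ (i : ℕ) ∧ (i : ℕ) < g₁) ∧
          (x = PuncturedSurfaceGroup.a i ∨ x = PuncturedSurfaceGroup.b i)) ∨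
        (∃ j : Fin r, (s₁ ≤ (j : ℕ) ∧ (j : ℕ) < s₂) ∧ x = PuncturedSurfaceGroup.c j) ∨
        x = εA ∨ x = η}).map ι).topologicalClosure)
    (hV₁ : G.vertGp v₁ = ((Subgroup.closure {x : PuncturedSurfaceGroup g r |
        (∃ i : Fin g, g₁ ≤ (i : ℕ) ∧ (x = PuncturedSurfaceGroup.a i ∨ x = PuncturedSurfaceGroup.b i)) ∨
        (∃ j : Fin r, (j : ℕ) < s₁ ∧ x = PuncturedSurfaceGroup.c j) ∨ x = η}).map ι).topologicalClosure)
    (nA nB : G.graph.N) (hN : ∀ n, n = nA ∨ n = nB)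
    (hEA : G.nodeGp nA = ((Subgroup.zpowers εA).map ι).topologicalClosure)
    (hEB : G.nodeGp nB = ((Subgroup.zpowers η).map ι).topologicalClosure)
    (hgen₀ : G.genus v₀ = g₀) (hgenm : G.genus vm = g₁ - g₀) (hgen₁ : G.genus v₁ = g - g₁) :
    (G.VerticialOpenInterDeterminesVertex ∧ G.EdgeLikeOpenInterDeterminesEdge ∧
      G.UnrVerticialOpenInterDeterminesVertex) ∧
    (G.VerticialEdgeLikeCommensurablyTerminal ∧ G.UnrVerticialCommensurablyTerminal) :=
  G.prop12_of_separating (G.separatingCoverings_of_threeChain_unmarkedMid hne hprime ι hι hg₀ hg hg₁ hs₁ hs₁r hs₂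
    e hC v₀ vm v₁ hV εA η hεA hη hV₀ hVm hV₁ nA nB hN hEA hEB hgen₀ hgenm hgen₁)

end Datum

/-! ### Rows F-2830, F-0438, F-0459 at the origin of all three-chains with an unmarked middle component -/

/-- **Row F-2830 `SeparatingCoveringsHolds Ω`, F-0438 `CommensurableTerminalityHolds Ω` (both clauses) and
F-0459 `OpenInterDeterminesComponentHolds Ω` at the INHABITED origin of ALL three-component chain data whose
middle component is unmarked** (`s₁ = s₂`, `1 ≤ s₁ < r`, `1 ≤ g₀ < g₁ < g`, genus pins; profinite pro-`Σ`
completions in `Type`); inhabited by the chain `Γ_{3,3}` of genera `(1,1,1)` with two marked points on `C₀`, none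
on `C_mid`, one on `C₁`. [cite: MochizukiCombGC2007, Prop 1.2 pp.8-9] -/
theorem exists_threeChainUnmarkedMidOrigin_prop12_holds_all (Sigma : Set ℕ) (hne : Sigma.Nonempty)
    (hprime : ∀ p ∈ Sigma, p.Prime) :
    ∃ Ω : PSCOrigin.{0},
      (∃ (Q : ProfiniteGrp.{0}) (G : PSCDatum Q), Ω.IsOfPSCType G ∧ G.Sigma = Sigma ∧
        G.graph.i = 3 ∧ G.graph.n = 2 ∧ G.graph.r = 3 ∧ ∃ v₀ vm v₁ : G.graph.V, (∀ w, w = v₀ ∨ w = vm ∨ w = v₁) ∧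
          G.genus v₀ = 1 ∧ G.genus vm = 1 ∧ G.genus v₁ = 1) ∧
      SeparatingCoveringsHolds Ω ∧ CommensurableTerminalityHolds Ω ∧ OpenInterDeterminesComponentHolds Ω := by
  classical
  let Ω : PSCOrigin.{0} :=
    ⟨fun {Q} _ _ G => ∃ (_ : IsTopologicalGroup Q), CompactSpace Q ∧ T2Space Q ∧ TotallyDisconnectedSpace Q ∧
      ∃ (S : Set ℕ) (g r g₀ g₁ s₁ s₂ : ℕ) (ι : PuncturedSurfaceGroup g r →* Q) (e : G.graph.C ≃ Fin r)
        (v₀ vm v₁ : G.graph.V) (nA nB : G.graph.N) (εA η : PuncturedSurfaceGroup g r),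
        S.Nonempty ∧ (∀ p ∈ S, p.Prime) ∧ IsProSigmaCompletion S ι ∧ 1 ≤ g₀ ∧ g₀ < g₁ ∧ g₁ < g ∧ 1 ≤ s₁ ∧
        s₁ < r ∧ s₂ = s₁ ∧
        (∀ c, G.cuspGp c =
          ((PuncturedSurfaceGroup.cuspInertia (g := g) (e c)).map ι).topologicalClosure) ∧
        (∀ w, w = v₀ ∨ w = vm ∨ w = v₁) ∧ (∀ n, n = nA ∨ n = nB) ∧
        εA = ((List.finRange r).map fun j : Fin r =>
            if s₂ ≤ (j : ℕ) then PuncturedSurfaceGroup.c (g := g) j else 1).prod *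
          ((List.finRange g).map fun i : Fin g => if (i : ℕ) < g₀ then
            PuncturedSurfaceGroup.a (r := r) i * PuncturedSurfaceGroup.b i *
              (PuncturedSurfaceGroup.a i)⁻¹ * (PuncturedSurfaceGroup.b i)⁻¹ else 1).prod ∧
        η = ((List.finRange r).map fun j : Fin r =>
            if s₁ ≤ (j : ℕ) then PuncturedSurfaceGroup.c (g := g) j else 1).prod *
          ((List.finRange g).map fun i : Fin g => if (i : ℕ) < g₁ then
            PuncturedSurfaceGroup.a (r := r) i * PuncturedSurfaceGroup.b i *
              (PuncturedSurfaceGroup.a i)⁻¹ * (PuncturedSurfaceGroup.b i)⁻¹ else 1).prod ∧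
        G.vertGp v₀ = ((Subgroup.closure {x : PuncturedSurfaceGroup g r |
          (∃ i : Fin g, (i : ℕ) < g₀ ∧ (x = PuncturedSurfaceGroup.a i ∨ x = PuncturedSurfaceGroup.b i)) ∨
          ∃ j : Fin r, s₂ ≤ (j : ℕ) ∧ x = PuncturedSurfaceGroup.c j}).map ι).topologicalClosure ∧
        G.vertGp vm = ((Subgroup.closure {x : PuncturedSurfaceGroup g r |
          (∃ i : Fin g, (g₀ ≤ (i : ℕ) ∧ (i : ℕ) < g₁) ∧
            (x = PuncturedSurfaceGroup.a i ∨ x = PuncturedSurfaceGroup.b i)) ∨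
          (∃ j : Fin r, (s₁ ≤ (j : ℕ) ∧ (j : ℕ) < s₂) ∧ x = PuncturedSurfaceGroup.c j) ∨
          x = εA ∨ x = η}).map ι).topologicalClosure ∧
        G.vertGp v₁ = ((Subgroup.closure {x : PuncturedSurfaceGroup g r |
          (∃ i : Fin g, g₁ ≤ (i : ℕ) ∧ (x = PuncturedSurfaceGroup.a i ∨ x = PuncturedSurfaceGroup.b i)) ∨
          (∃ j : Fin r, (j : ℕ) < s₁ ∧ x = PuncturedSurfaceGroup.c j) ∨ x = η}).map ι).topologicalClosure ∧
        G.nodeGp nA = ((Subgroup.zpowers εA).map ι).topologicalClosure ∧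
        G.nodeGp nB = ((Subgroup.zpowers η).map ι).topologicalClosure ∧
        G.genus v₀ = g₀ ∧ G.genus vm = g₁ - g₀ ∧ G.genus v₁ = g - g₁⟩
  have hsep : SeparatingCoveringsHolds Ω := by
    intro Q _ _ _ G hG
    obtain ⟨_, hc, ht, hd, S, g, r, g₀, g₁, s₁, s₂, ι, e, v₀, vm, v₁, nA, nB, εA, η, hSne, hSp, hι, hg₀, hg,
      hg₁, hs₁, hs₁r, hs₂, hC, hV, hN, hεA, hη, hV₀, hVm, hV₁, hEA, hEB, hgen₀, hgenm, hgen₁⟩ := hG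
    haveI := hc
    haveI := hd
    exact G.separatingCoverings_of_threeChain_unmarkedMid hSne hSp ι hι hg₀ hg hg₁ hs₁ hs₁r hs₂ e hC v₀ vm v₁ hV
      εA η hεA hη hV₀ hVm hV₁ nA nB hN hEA hEB hgen₀ hgenm hgen₁
  have hprof : ∀ ⦃Q : Type⦄ [Group Q] [TopologicalSpace Q] [IsTopologicalGroup Q] (G : PSCDatum Q),
      Ω.IsOfPSCType G → CompactSpace Q ∧ TotallyDisconnectedSpace Q := fun Q _ _ _ G hG => by
    obtain ⟨_, hc, -, hd, -⟩ := hG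
    exact ⟨hc, hd⟩
  refine ⟨Ω, ?_, hsep, commensurableTerminalityHolds_of_separating Ω hsep hprof,
    openInterDeterminesComponentHolds_of_separating Ω hsep hprof⟩
  -- the member: `Γ_{3,3}`, genera `(1,1,1)`, marked points `c₁, c₂` on `C₀`, `c₀` on `C₁`
  obtain ⟨Q, ι, G, e, v₀, vm, v₁, nA, nB, εA, η, hι, hS, hi, hn, hr, hC, hV, hN, hεA, hη, hV₀, hVm, hV₁,
    hEA, hEB, hgen₀, hgenm, hgen₁, -, -⟩ := exists_threeChainDatum Sigma hne hprime 3 3 1 2 1 1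
  refine ⟨Q, G, ?_, hS, hi, hn, hr, v₀, vm, v₁, hV, hgen₀, hgenm, hgen₁⟩
  exact ⟨inferInstance, inferInstance, inferInstance, inferInstance, Sigma, 3, 3, 1, 2, 1, 1, ι, e, v₀, vm, v₁,
    nA, nB, εA, η, hne, hprime, hι, le_rfl, by norm_num, by norm_num, le_rfl, by norm_num, rfl, hC, hV, hN, hεA,
    hη, hV₀, hVm, hV₁, hEA, hEB, hgen₀, hgenm, hgen₁⟩

end PSCDatum

end Literature.AnabelianGeometry.SemiGraphs

end
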